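import Summits.RiemannHypothesis.RiemannHypothesis.Theorems.LiDirichletEchoResonantMainComplex
import Summits.RiemannHypothesis.RiemannHypothesis.Theorems.LiDirichletEchoNonresonantChar
import Summits.RiemannHypothesis.RiemannHypothesis.Theorems.LiPrimeEchoStationaryFree
import HarnessLib

/-!
# RiemannHypothesis / LiDirichletEcho — crux K2χ `LiPrimeEdgeEchoChar`, part 3: the resonant piece is the TWISTED echo
# (RH-FREE, GRH-FREE)

RH-FREE · GRH-FREE [rh-li-eng g5, acting as prover on the unstaffed route].  Route `Theses/LiDirichletEcho.lean` (rung
«Li PRIME-ECHO LAW FOR DIRICHLET CHARACTERS» `LiTheory.LiZeroWindowEchoDirichlet`, L-P(P1χ)), item `LiPrimeEdgeEchoChar`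
(stmt-RiemannHypothesis-19393), stub E₁χ of the birth skeleton (`stub_m2_twisted`).  (1) `resonant_integral_close`: the
COMPLEX form of ζ's resonant evaluation — for `c ≥ 5/4`, `n ≥ 400`, `√n ≤ T₁ ≤ √n + 1`, `c√n ≤ T₂ ≤ c√n + 1`,
`‖∫_{T₁}^{T₂} g e^{iP} dy − π A₂ n^{1/4} e^{−i(2√(n log 2)+π/4)}‖ ≤ C_c log n`: the error terms of the weighted sharp
stationary phase theorem with free ends (`PrimeEdge.weightedStationaryPhase_free_neg`; concave case `n/(2T₂³) ≤ −P″ ≤ 3n/T₁³`,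
`|P‴| ≤ 19n/T₁⁴`, `|g′| ≤ 2nκe/T₁³`) are `O_c(log n)` — this part is ζ's `PrimeEdge.edgeTwo_resonant` VERBATIM, which
already bounds the complex difference `‖J − main term‖` — and the main term is the complex chirp up to `400`
(part 2, `CharPrimeEdge.main_term_close_complex`).  (2) `charEdgeTwo_resonant`: multiplying by the constant `χ(2)`
(`‖χ(2)‖ ≤ 1`) and taking `(1/π) Re`, `|charEdgeTwo χ n T₁ T₂ − liPrimeEchoTwist (χ 2) 2 n| ≤ C_c log n` uniformly in `χ`
(`Re[χ(2) · chirp] = π · liPrimeEchoTwist (χ 2) 2 n`, the TYPED convention `χ(2)` — not `χ̄(2)` — of the route, cf. the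
cell's certified guard row DATA.md §N).  Nothing here bears on the truth of RH or GRH.
-/

noncomputable section

-- D-0017: `Summit.<S>.<S>.…` is the designed namespace of a single-problem summit.
set_option linter.dupNamespace false

open Complex MeasureTheory intervalIntegral Set
open scoped Real Interval ArithmeticFunction.vonMangoldt
open Literature.Analysis.Fourier

namespace Summit.RiemannHypothesis.RiemannHypothesis.Theorems.LiTheory

namespace CharPrimeEdge

open PrimeEdge

/-- **The resonant integral is the COMPLEX chirp up to `O_c(log n)`**: for `c ≥ 5/4` there are `N` and `C ≥ 0` with
`‖∫_{T₁}^{T₂} g e^{iP} dy − chirpTwo n‖ ≤ C log n` for `n ≥ N`, `√n ≤ T₁ ≤ √n + 1`, `c√n ≤ T₂ ≤ c√n + 1`. -/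
theorem resonant_integral_close {c : ℝ} (hc : 5 / 4 ≤ c) :
    ∃ N : ℕ, ∃ C : ℝ, 0 ≤ C ∧ ∀ n : ℕ, N ≤ n → ∀ T₁ T₂ : ℝ,
      Real.sqrt n ≤ T₁ → T₁ ≤ Real.sqrt n + 1 → c * Real.sqrt n ≤ T₂ → T₂ ≤ c * Real.sqrt n + 1 →
        ‖(∫ y in T₁..T₂, (gA n y : ℂ) * Complex.exp (I * Ph n y)) - chirpTwo n‖ ≤ C * Real.log n := by
  -- adapted from `PrimeEdge.edgeTwo_resonant` (Theorems/LiPrimeEchoLiPrimeEdgeEcho.lean, route LiPrimeEcho): the error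
  -- analysis is verbatim; the conclusion keeps the complex difference and uses `main_term_close_complex`.
  set B : ℝ := (c + 1) ^ 15 with hB
  set Kc : ℝ := Real.log (2 * c + 3) with hKc
  have hc1 : 1 ≤ c + 1 := by linarith
  have hB1 : 1 ≤ B := one_le_pow₀ hc1
  have hKc0 : 0 ≤ Kc := Real.log_nonneg (by linarith)
  refine ⟨400, 1000000 * B ^ 2 * (Kc + 1) + 400, by positivity, fun n hn T₁ T₂ h1 h1' h2 h2' ↦ ?_⟩
  -- ### the window
  obtain ⟨hq20, hq2⟩ := sqrt_facts hn
  set q : ℝ := Real.sqrt n with hq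
  have hn1 : 1 ≤ n := le_trans (by norm_num) hn
  have hn' : (400 : ℝ) ≤ n := by exact_mod_cast hn
  have hn0 : (0 : ℝ) < n := by linarith only [hn']
  set α := T₁ with hα
  set β := T₂ with hβ
  have hα1 : 1 ≤ α := by linarith only [hq20, h1]
  have hα3 : 3 ≤ α := by linarith only [hq20, h1]
  have hα0 : 0 < α := by linarith only [hα1]
  have hα2q : α ≤ 2 * q := by linarith only [h1', hq20]
  have hαn : (n : ℝ) ≤ α ^ 2 := by nlinarith only [h1, hq2, hq20]
  have hβα : β ≤ (c + 1) * α := by nlinarith only [h2', h1, hα1, hc, hq20]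
  have hβ0 : 0 < β := by nlinarith only [h2, hc, hq20]
  obtain ⟨s, hsα, hsβ, hstat⟩ := exists_stationary hc hn h1 h1' h2
  have hαs : α < s := by linarith only [hsα, hq20]
  have hsb : s < β := by linarith only [hsβ, hq20]
  have hs : q ≤ s := by linarith only [h1, hαs]
  -- ### parameters of the stationary phase theorem
  set rr : ℝ := n / (2 * β ^ 3) with hrr
  have hrr0 : 0 < rr := by positivity
  set A : ℝ := 6 * (c + 1) ^ 3 with hA
  have hA1 : 1 ≤ A := by have := one_le_pow₀ (n := 3) hc1; linarith only [this]
  set lam3 : ℝ := 19 * n / α ^ 4 with hlam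
  set G₁ : ℝ := 2 * n * (kap * Real.exp 1) / α ^ 3 with hG₁
  have hke := kap_mul_exp_le
  have hk0 := kap_pos
  -- ### the theorem
  have key := weightedStationaryPhase_free_neg (P := Ph n) (P' := fun y ↦ n * ua y - Real.log 2)
    (P'' := fun y ↦ (n : ℝ) * ub y) (P''' := fun y ↦ (n : ℝ) * uc y) (g := gA n)
    (g' := fun y ↦ -(2 * n * y / Qd y) * gA n y) (α := α) (β := β) (c := s) (r := rr) (A := A) (lam3 := lam3) (G₁ := G₁)
    hαs hsb hrr0 hA1
    (fun y _ ↦ hasDerivAt_Ph n y) (fun y _ ↦ hasDerivAt_Ph' n y) (fun y _ ↦ hasDerivAt_Ph'' n y)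
    (fun y hy ↦ by
      have hy3 : 3 ≤ y := hα3.trans hy.1
      have hy0 : 0 < y := by linarith only [hy3]
      constructor
      · -- `rr ≤ n(−u₁(y))`: `−u₁ ≥ 1/(2y³) ≥ 1/(2β³)`
        have h := le_neg_ub hy3
        have hyβ : 1 / (2 * β ^ 3) ≤ 1 / (2 * y ^ 3) := by
          apply div_le_div_of_nonneg_left (by norm_num) (by positivity)
          nlinarith only [pow_le_pow_left₀ hy0.le hy.2 3]
        show rr ≤ -((n : ℝ) * ub y)
        calc rr = n * (1 / (2 * β ^ 3)) := by rw [hrr]; ring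
          _ ≤ n * (1 / (2 * y ^ 3)) := by gcongr
          _ ≤ n * (-ub y) := by gcongr
          _ = -((n : ℝ) * ub y) := by ring
      · -- `n(−u₁(y)) ≤ 3n/y³ ≤ 3n/α³ ≤ A rr`
        have h := neg_ub_le hy0
        have hyα : 3 / y ^ 3 ≤ 3 / α ^ 3 :=
          div_le_div_of_nonneg_left (by norm_num) (by positivity) (pow_le_pow_left₀ hα0.le hy.1 3)
        have hAr : 3 / α ^ 3 ≤ A * rr / n := by
          rw [hA, hrr, div_le_div_iff₀ (by positivity) hn0]
          have hβ3 : β ^ 3 ≤ (c + 1) ^ 3 * α ^ 3 := by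
            rw [← mul_pow]; exact pow_le_pow_left₀ hβ0.le hβα 3
          have : 6 * (c + 1) ^ 3 * (n / (2 * β ^ 3)) * α ^ 3 = 3 * n * ((c + 1) ^ 3 * α ^ 3 / β ^ 3) := by
            field_simp
            norm_num
          rw [this]
          have h1 : 1 ≤ (c + 1) ^ 3 * α ^ 3 / β ^ 3 := by rw [le_div_iff₀ (by positivity)]; linarith only [hβ3]
          nlinarith only [h1, hn0]
        show -((n : ℝ) * ub y) ≤ A * rr
        calc -((n : ℝ) * ub y) = n * (-ub y) := by ring
          _ ≤ n * (3 / y ^ 3) := by gcongr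
          _ ≤ n * (A * rr / n) := mul_le_mul_of_nonneg_left (hyα.trans hAr) hn0.le
          _ = A * rr := by field_simp)
    (fun y hy ↦ by
      have hy1 : 1 ≤ y := hα1.trans hy.1
      show |(n : ℝ) * uc y| ≤ lam3
      rw [abs_mul, abs_of_nonneg hn0.le, hlam]
      calc (n : ℝ) * |uc y| ≤ n * (19 / y ^ 4) := mul_le_mul_of_nonneg_left (abs_uc_le hy1) hn0.le
        _ ≤ n * (19 / α ^ 4) := by
            gcongr _ * ?_
            exact div_le_div_of_nonneg_left (by norm_num) (by positivity) (pow_le_pow_left₀ hα0.le hy.1 4)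
        _ = 19 * n / α ^ 4 := by ring)
    (by show (n : ℝ) * ua s - Real.log 2 = 0; rw [hstat]; ring)
    (fun y _ ↦ hasDerivAt_gA n y) ((continuous_gA' n).continuousOn)
    (fun y hy ↦ by
      have hy0 : 0 < y := by linarith only [hα1, hy.1]
      have hyq : q ≤ y := h1.trans hy.1
      refine (abs_gA'_le n hyq hy0).trans ?_
      rw [hG₁]
      exact div_le_div_of_nonneg_left (by positivity) (by positivity) (pow_le_pow_left₀ hα0.le hy.1 3))
  -- ### the error terms are `O_c(log n)`
  set ln : ℝ := Real.log n with hln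
  have hln1 : 1 ≤ ln := by
    rw [hln, ← Real.log_exp 1]
    refine Real.log_le_log (Real.exp_pos 1) ?_
    have := Real.exp_one_lt_d9
    linarith only [this, hn']
  have hlnq : Real.log q = ln / 2 := by
    rw [hq, Real.log_sqrt hn0.le, hln]
  -- `1/rr ≤ 16 (c+1)³ q`
  have hα3q : α ^ 3 ≤ 8 * (n * q) := by
    have : α ^ 3 ≤ (2 * q) ^ 3 := pow_le_pow_left₀ hα0.le hα2q 3
    have e : (2 * q) ^ 3 = 8 * (q ^ 2 * q) := by ring
    rw [e, hq2] at this; exact this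
  have hβ3 : β ^ 3 ≤ (c + 1) ^ 3 * α ^ 3 := by rw [← mul_pow]; exact pow_le_pow_left₀ hβ0.le hβα 3
  have hinv : 1 / rr ≤ 16 * (c + 1) ^ 3 * q := by
    rw [hrr, one_div_div, div_le_iff₀ hn0]
    nlinarith only [hβ3, hα3q, one_le_pow₀ (n := 3) hc1, hn0, hq20]
  have hc3B : (c + 1) ^ 3 ≤ B := by rw [hB]; exact pow_le_pow_right₀ hc1 (by norm_num)
  -- (E1) `2/(rr(s − α)) ≤ 320 (c+1)³`
  have hE1 : 2 / (rr * (s - α)) ≤ 320 * B := by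
    have hsa : q / 10 ≤ s - α := by linarith only [hsα]
    have : 2 / (rr * (s - α)) = 2 * (1 / rr) / (s - α) := by field_simp
    rw [this, div_le_iff₀ (by linarith only [hαs])]
    calc 2 * (1 / rr) ≤ 2 * (16 * (c + 1) ^ 3 * q) := by gcongr
      _ = 320 * (c + 1) ^ 3 * (q / 10) := by ring
      _ ≤ 320 * B * (s - α) := by gcongr
  -- (E2) `2/(rr(β − s)) ≤ 800 (c+1)³`
  have hE2 : 2 / (rr * (β - s)) ≤ 800 * B := by
    have hbs : q / 25 ≤ β - s := by linarith only [hsβ]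
    have : 2 / (rr * (β - s)) = 2 * (1 / rr) / (β - s) := by field_simp
    rw [this, div_le_iff₀ (by linarith only [hsb])]
    calc 2 * (1 / rr) ≤ 2 * (16 * (c + 1) ^ 3 * q) := by gcongr
      _ = 800 * (c + 1) ^ 3 * (q / 25) := by ring
      _ ≤ 800 * B * (β - s) := by gcongr
  -- (E3) `lam3/rr² ≤ 304 (c+1)⁶`
  have hE3 : lam3 / rr ^ 2 ≤ 304 * (c + 1) ^ 6 := by
    rw [hlam, hrr]
    have hα2 : α ^ 2 ≤ 4 * n := by nlinarith only [hα2q, hq2, hα0]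
    have hβ6 : β ^ 6 ≤ (c + 1) ^ 6 * α ^ 6 := by rw [← mul_pow]; exact pow_le_pow_left₀ hβ0.le hβα 6
    rw [div_pow, div_div_eq_mul_div, div_le_iff₀ (by positivity)]
    -- `19 n (2β³)²/α⁴ ≤ 304 (c+1)⁶ n²`
    rw [div_mul_eq_mul_div, div_le_iff₀ (by positivity)]
    have : (2 * β ^ 3) ^ 2 = 4 * β ^ 6 := by ring
    rw [this]
    have h76 : 19 * (n : ℝ) * (4 * β ^ 6) ≤ 76 * n * ((c + 1) ^ 6 * α ^ 6) := by nlinarith only [hβ6, hn0]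
    have h2 : 76 * (n : ℝ) * ((c + 1) ^ 6 * α ^ 6) ≤ 304 * (c + 1) ^ 6 * (n : ℝ) ^ 2 * α ^ 4 := by
      have : (0 : ℝ) ≤ 76 * n * (c + 1) ^ 6 * α ^ 4 := by positivity
      nlinarith only [hα2, this]
    linarith only [h76, h2]
  -- (E4) the logarithms
  have hsr : Real.sqrt rr ≤ 1 := by
    rw [Real.sqrt_le_one]
    rw [hrr, div_le_one (by positivity)]
    have : (n : ℝ) * q ≤ α ^ 3 := by
      calc (n : ℝ) * q = q ^ 3 := by rw [← hq2]; ring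
        _ ≤ α ^ 3 := pow_le_pow_left₀ (by linarith only [hq20]) h1 3
    have hαβ3 : α ^ 3 ≤ β ^ 3 := pow_le_pow_left₀ hα0.le (by linarith only [hαs, hsb]) 3
    nlinarith only [this, hαβ3, hq20, hn0]
  have hLog : ∀ d : ℝ, 0 ≤ d → d ≤ β → Real.log (1 + d * Real.sqrt rr) ≤ Kc + ln := by
    intro d hd0 hdβ
    have hd1 : 1 + d * Real.sqrt rr ≤ (2 * c + 3) * q := by
      have : d * Real.sqrt rr ≤ β := by
        calc d * Real.sqrt rr ≤ β * 1 := mul_le_mul hdβ hsr (Real.sqrt_nonneg _) hβ0.le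
          _ = β := mul_one β
      nlinarith only [this, hβα, hα2q, hq20, hc]
    calc Real.log (1 + d * Real.sqrt rr) ≤ Real.log ((2 * c + 3) * q) :=
          Real.log_le_log (by positivity) hd1
      _ = Kc + Real.log q := by rw [Real.log_mul (by positivity) (by positivity), hKc]
      _ ≤ Kc + ln := by rw [hlnq]; linarith only [hln1]
  have hL1 := hLog (s - α) (by linarith only [hαs]) (by linarith only [hsb, hα0])
  have hL2 := hLog (β - s) (by linarith only [hsb]) (by linarith only [hαs, hα0])
  have hL10 : 0 ≤ Real.log (1 + (s - α) * Real.sqrt rr) :=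
    Real.log_nonneg (by nlinarith only [Real.sqrt_nonneg rr, hαs])
  have hL20 : 0 ≤ Real.log (1 + (β - s) * Real.sqrt rr) :=
    Real.log_nonneg (by nlinarith only [Real.sqrt_nonneg rr, hsb])
  -- (E5) `G₁/rr ≤ 3 (c+1)³`
  have hE5 : G₁ / rr ≤ 3 * B := by
    have e : G₁ / rr = 4 * (kap * Real.exp 1) * (β ^ 3 / α ^ 3) := by
      rw [hG₁, hrr]; field_simp; ring
    have hrat : β ^ 3 / α ^ 3 ≤ (c + 1) ^ 3 := by rw [div_le_iff₀ (by positivity)]; exact hβ3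
    have h4 : 4 * (kap * Real.exp 1) ≤ 3 := by nlinarith only [kap_le, Real.exp_one_lt_d9, hk0, Real.exp_pos 1]
    rw [e]
    calc 4 * (kap * Real.exp 1) * (β ^ 3 / α ^ 3) ≤ 3 * (c + 1) ^ 3 :=
          mul_le_mul h4 hrat (by positivity) (by norm_num)
      _ ≤ 3 * B := by linarith only [hc3B]
  -- ### summing up
  set L₁ : ℝ := Real.log (1 + (s - α) * Real.sqrt rr) with hL₁
  set L₂ : ℝ := Real.log (1 + (β - s) * Real.sqrt rr) with hL₂
  set M : ℝ := B ^ 2 * (Kc + 1) * ln with hM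
  have hBB : B ≤ B ^ 2 := le_self_pow₀ hB1 two_ne_zero
  have hKl : 1 ≤ (Kc + 1) * ln := by nlinarith only [hKc0, hln1]
  have hBM : B ≤ M := by
    rw [hM]
    nlinarith only [mul_nonneg (sq_nonneg B) (sub_nonneg.2 hKl), hBB]
  have hKcl : Kc ≤ Kc * ln := le_mul_of_one_le_right hKc0 hln1
  have hKl0 : 0 ≤ Kc * ln := by positivity
  have eK : (Kc + 1) * ln = Kc * ln + ln := by ring
  have hLL : 2 + L₁ + L₂ ≤ 4 * ((Kc + 1) * ln) := by rw [eK]; linarith only [hL1, hL2, hln1, hKcl, hKl0]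
  have hLL' : L₁ + L₂ ≤ 2 * ((Kc + 1) * ln) := by rw [eK]; linarith only [hL1, hL2, hln1, hKcl, hKl0]
  have hA3 : 2 * A ^ 3 * (lam3 / rr ^ 2) ≤ 131328 * B := by
    have e : 2 * A ^ 3 = 432 * (c + 1) ^ 9 := by rw [hA]; ring
    rw [e]
    calc 432 * (c + 1) ^ 9 * (lam3 / rr ^ 2) ≤ 432 * (c + 1) ^ 9 * (304 * (c + 1) ^ 6) := by gcongr
      _ = 131328 * B := by rw [hB]; ring
  have h1A : 1 + A ≤ 7 * B := by rw [hA]; linarith only [hc3B, hB1]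
  have hg1 : |gA n s| ≤ 1 := by
    rw [abs_of_pos (gA_pos n s)]
    exact ((gA_bounds n hs (by linarith only [hq20, hs])).2).trans hke
  have hfirst : |gA n s| * (2 / (rr * (s - α)) + 2 / (rr * (β - s)) + 2 * A ^ 3 * (lam3 / rr ^ 2) * (2 + L₁ + L₂))
      ≤ 526432 * M := by
    have hbr : 2 / (rr * (s - α)) + 2 / (rr * (β - s)) + 2 * A ^ 3 * (lam3 / rr ^ 2) * (2 + L₁ + L₂)
        ≤ 1120 * B + 131328 * B * (4 * ((Kc + 1) * ln)) := by
      have : 2 * A ^ 3 * (lam3 / rr ^ 2) * (2 + L₁ + L₂) ≤ 131328 * B * (4 * ((Kc + 1) * ln)) :=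
        mul_le_mul hA3 hLL (by linarith only [hL10, hL20]) (by positivity)
      linarith only [hE1, hE2, this]
    have hbr0 : 0 ≤ 2 / (rr * (s - α)) + 2 / (rr * (β - s)) + 2 * A ^ 3 * (lam3 / rr ^ 2) * (2 + L₁ + L₂) := by
      have : 0 < s - α := by linarith only [hαs]
      have : 0 < β - s := by linarith only [hsb]
      positivity
    calc |gA n s| * _ ≤ 1 * (1120 * B + 131328 * B * (4 * ((Kc + 1) * ln))) :=
          mul_le_mul hg1 hbr hbr0 (by norm_num)
      _ = 1120 * B + 525312 * (B * ((Kc + 1) * ln)) := by ring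
      _ ≤ 1120 * M + 525312 * M := by
          have : B * ((Kc + 1) * ln) ≤ M := by rw [hM]; nlinarith only [hBB, hKl]
          linarith only [hBM, this]
      _ = 526432 * M := by ring
  have hsecond : G₁ / rr * (6 + (1 + A) * (L₁ + L₂)) ≤ 60 * M := by
    have hbr : 6 + (1 + A) * (L₁ + L₂) ≤ 6 + 7 * B * (2 * ((Kc + 1) * ln)) := by
      have := mul_le_mul h1A hLL' (by linarith only [hL10, hL20]) (by positivity)
      linarith only [this]
    calc G₁ / rr * (6 + (1 + A) * (L₁ + L₂)) ≤ 3 * B * (6 + 7 * B * (2 * ((Kc + 1) * ln))) :=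
          mul_le_mul hE5 hbr (by positivity) (by positivity)
      _ = 18 * B + 42 * (B ^ 2 * ((Kc + 1) * ln)) := by ring
      _ ≤ 18 * M + 42 * M := by
          have : B ^ 2 * ((Kc + 1) * ln) = M := by rw [hM]; ring
          linarith only [hBM, this]
      _ = 60 * M := by ring
  have hERR := key.trans (add_le_add hfirst hsecond)
  -- ### the main term and the conclusion (complex)
  have hmain := main_term_close_complex hn hs hstat
  set J : ℂ := ∫ y in α..β, (gA n y : ℂ) * Complex.exp (I * Ph n y) with hJ
  set Mt : ℂ := (gA n s : ℂ) * ((starRingEnd ℂ) fresnelC * Complex.exp (I * Ph n s) *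
    ((Real.sqrt (-(n * ub s)))⁻¹ : ℝ)) with hMt
  have hM0 : 0 ≤ M := by rw [hM]; positivity
  calc ‖J - chirpTwo n‖ = ‖(J - Mt) + (Mt - chirpTwo n)‖ := by rw [sub_add_sub_cancel]
    _ ≤ ‖J - Mt‖ + ‖Mt - chirpTwo n‖ := norm_add_le _ _
    _ ≤ 526432 * M + 60 * M + 400 := add_le_add hERR hmain
    _ ≤ (1000000 * B ^ 2 * (Kc + 1) + 400) * ln := by
        rw [hM]; nlinarith only [hM0, hln1, hM, hB1, hKc0]

variable {q : ℕ}

/-- `charEdgeTwo` in polar form: `(1/π) Re[χ(2) · ∫ g e^{iP}]`. -/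
theorem charEdgeTwo_eq_polar (χ : DirichletCharacter ℂ q) (n : ℕ) (T₁ T₂ : ℝ) :
    charEdgeTwo χ n T₁ T₂ =
      1 / Real.pi * (χ (2 : ZMod q) * ∫ y in T₁..T₂, (gA n y : ℂ) * Complex.exp (I * Ph n y)).re := by
  rw [charEdgeTwo]
  congr 3
  exact intervalIntegral.integral_congr fun y _ ↦ resonant_polar n y

/-- **Stub E₁χ (`stub_m2_twisted`) of the birth skeleton: the resonant piece is the TWISTED echo,
`|charEdgeTwo χ n T₁ T₂ − liPrimeEchoTwist (χ 2) 2 n| ≤ C_c log n`, uniformly in the character `χ`.** -/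
theorem charEdgeTwo_resonant {c : ℝ} (hc : 5 / 4 ≤ c) :
    ∃ N : ℕ, ∃ C : ℝ, ∀ (χ : DirichletCharacter ℂ q) (n : ℕ), N ≤ n → ∀ T₁ T₂ : ℝ,
      Real.sqrt n ≤ T₁ → T₁ ≤ Real.sqrt n + 1 → c * Real.sqrt n ≤ T₂ → T₂ ≤ c * Real.sqrt n + 1 →
        |charEdgeTwo χ n T₁ T₂ - liPrimeEchoTwist (χ (2 : ZMod q)) 2 n| ≤ C * Real.log n := by
  obtain ⟨N, C, hC0, hN⟩ := resonant_integral_close hc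
  refine ⟨max N 1, C, fun χ n hn T₁ T₂ h1 h1' h2 h2' ↦ ?_⟩
  have hnN : N ≤ n := le_trans (le_max_left _ _) hn
  have hn1 : 1 ≤ n := le_trans (le_max_right _ _) hn
  have hlog : 0 ≤ Real.log n := Real.log_nonneg (by exact_mod_cast hn1)
  have hD := hN n hnN T₁ T₂ h1 h1' h2 h2'
  set J : ℂ := ∫ y in T₁..T₂, (gA n y : ℂ) * Complex.exp (I * Ph n y) with hJ
  set z : ℂ := χ (2 : ZMod q) with hz
  have hz1 : ‖z‖ ≤ 1 := DirichletCharacter.norm_le_one χ _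
  have htw : liPrimeEchoTwist z 2 n = 1 / Real.pi * (z * chirpTwo n).re := by
    rw [re_mul_chirpTwo]; field_simp
  rw [charEdgeTwo_eq_polar, htw, ← mul_sub, ← Complex.sub_re, ← mul_sub, abs_mul,
    abs_of_pos (by positivity : (0 : ℝ) < 1 / Real.pi)]
  have hπ1 : 1 / Real.pi ≤ 1 := by rw [div_le_one Real.pi_pos]; linarith only [Real.pi_gt_three]
  calc 1 / Real.pi * |(z * (J - chirpTwo n)).re| ≤ 1 * (C * Real.log n) := by
        refine mul_le_mul hπ1 ?_ (abs_nonneg _) (by norm_num)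
        calc |(z * (J - chirpTwo n)).re| ≤ ‖z * (J - chirpTwo n)‖ := Complex.abs_re_le_norm _
          _ = ‖z‖ * ‖J - chirpTwo n‖ := norm_mul _ _
          _ ≤ 1 * (C * Real.log n) := mul_le_mul hz1 hD (norm_nonneg _) (by norm_num)
          _ = C * Real.log n := one_mul _
    _ = C * Real.log n := one_mul _

end CharPrimeEdge

end Summit.RiemannHypothesis.RiemannHypothesis.Theorems.LiTheory

-- (re-land 2026-08-26T14:2xZ: comment-only resubmission to re-enqueue the olean build lost in a gate reload window; no declaration changed)
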